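import Summits.AtomisticToContinuum.HydrodynamicLimit.Theses.OneFlightGossipEngine
import Summits.AtomisticToContinuum.HydrodynamicLimit.Theorems.TwoClocksClampedWindowDockGronwall
import Summits.AtomisticToContinuum.HydrodynamicLimit.Theorems.TwoClocksEntropyToHydro
import Summits.AtomisticToContinuum.HydrodynamicLimit.Theorems.OneFlightGossipEngineUniformLocalGibbsConcentration

/-!
# Crux `ClampedCurrentsDock` (stmt-AtomisticToContinuum-14680), line `IdeatorTwoSketch`: stub S1 `stub_reduction`

The line-independent REDUCTION of the dock
`Summit.AtomisticToContinuum.HydrodynamicLimit.Theses.OneFlightGossipEngine.ClampedCurrentsDock` to its Gronwall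
core: `CoreToHydro : RelEntropyCoreRf → DiluteSelfConsistency → HydrodynamicLimit`, where `RelEntropyCoreRf` is
Yau's relative-entropy estimate `KL(lawAt Φ λ_N t ‖ ψ_t)/(N+1) → 0` along the EXPLICIT reference family
`a_t = ρ_t · Rf(σ³ρ_t)` (the statement the ledger stub S7 of the line concludes). Both propositions are re-declared
here verbatim from the line skeleton `Cruxes/ClampedCurrentsDock/Lines/IdeatorTwoSketch.lean` (namespace
`…Cruxes.ClampedCurrentsDock.CoherenceNotTails`), so that the skeleton's `stub_reduction : CoreToHydro` is this
file's `stub_reduction` definitionally.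

All statics are discharged from PROVED tree theorems: the `η₀`-uniform exponential LLN
`uniformLocalGibbsConcentration_proof` (stmt-14445), the equation of state `HsEosLowDensity_holds` (stmt-0768), the
insertion factor `stub_eosRatioAnalytic`, the twin dock's bookkeeping (support item stmt-13735, parts I–III:
`EntropyClockDock.timeZero_slice`, `data_eq_of_ties`, `tie_of_expConc`, `activity_of_density`,
`tie_rhoLim_of_smallDensity`) and the entropy inequality `hydrodynamicLimit_of_relEntropyVanishing`
(`Theorems/TwoClocksEntropyToHydro`). The proof is the bookkeeping of
`EntropyClockDock.clampedWindowDock_of_core` / `clampedWindowDock_of_gronwallRf` (part IV of 13735) with the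
conclusion `TwoClocks.ClampedWindowDock` replaced by the sub-problem Statement: `σ₀ := min σc (min σd (min (1/2)
(η₀ ∫a₀ / sup a₀)))` (`σc` from the core, `σd` from `DiluteSelfConsistency` at `η := min η₁ (η₀/2)`, `η₁` the
packing threshold of the activity inversion); probability clause from `isProbabilityMeasure_localGibbsLaw`; the
`t = 0` slice from `timeZero_slice`; for `t > 0` the packing of `ρ_t`, the inverted activity, its `η₀`-diluteness,
the reference tie, data pinning of the anonymous LLN density of the matrix of 14445 to `ρ_t`, and `KL → 0` from the
core. Mass conservation / unit admissible mass are re-proved privately (as in part IV).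

prover-line-stmt-AtomisticToContinuum-14680-0 (stub worker S1).
-/

noncomputable section

namespace Summit.AtomisticToContinuum.HydrodynamicLimit.Theorems.ClampedCurrentsDockReduction

open scoped BigOperators ENNReal Classical
open MeasureTheory Filter Set Topology InformationTheory
open Literature.MathematicalPhysics.KineticTheory Literature.Analysis.FluidPDE Literature.Analysis.FunctionSpaces
open Summit.AtomisticToContinuum.HydrodynamicLimit.Theses.OneFlightGossipEngine
open Summit.AtomisticToContinuum.HydrodynamicLimit.Theorems
open Summit.AtomisticToContinuum.HydrodynamicLimit.Theorems.EntropyClockDock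

/-! ### §1 The statements (verbatim from the line skeleton) -/

/-- **The Gronwall core of the dock (Yau's relative-entropy estimate along the explicit reference family).**
The currency of the twin dock's reduction `EntropyClockDock.clampedWindowDock_of_gronwallRf` (13735, part IV)
with the kinetic/collisional/tail antecedents REMOVED (they are inputs of the ledger stub S7, which concludes
this statement) and the two static inputs kept: for every insertion factor `Rf` on `(−r, r)` handed over with
its four defining properties (`stub_eosRatioAnalytic` provides one), every `η₀ > 0` carrying the matrix of
`UniformLocalGibbsConcentration`, `HsEosLowDensity` and `DiluteSelfConsistency`: for continuous positive
profiles there is `σ₀ > 0` such that for `0 < σ < σ₀`, every classical hs-Euler solution on `[0,T)` tied at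
`t = 0`, every flow family, every `t ∈ (0,T)`, with `a_t := ρ_t · Rf(σ³ρ_t)` (facts `ρ_t ≤ a_t ≤ 2ρ_t`,
`SmallDensity (profileOf a_t) σ`, `rhoLim (profileOf a_t) σ = ρ_t` available as hypotheses),
`KL(lawAt Φ λ_N t ‖ localGibbsLaw σ a_t (u t) (θ t) N (Φ N))/(N+1) → 0`. Verbatim the line skeleton's
`CoherenceNotTails.RelEntropyCoreRf` (the hypothesis of this file's stub; concluded by the line's ledger stub). -/
def RelEntropyCoreRf : Prop :=
  ∀ (r : ℝ) (Rf : ℝ → ℝ), 0 < r →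
    (∀ x ∈ Ioo (-r) r, 0 < Rf x ∧ Rf x * (∑' j : ℕ, bE j / (j.factorial : ℝ) * (x * Rf x) ^ j) = 1) →
    (∀ x ∈ Icc 0 r, 1 ≤ Rf x ∧ Rf x ≤ 2) → ContinuousOn Rf (Icc 0 r) →
    (∀ x ∈ Ioo (-r) r, ∀ R ∈ Icc (1 / 2 : ℝ) 2,
      R * (∑' j : ℕ, bE j / (j.factorial : ℝ) * (x * R) ^ j) = 1 → R = Rf x) →
    ∀ η₀ : ℝ, 0 < η₀ →
    (∀ (a θ₀ : T3 → ℝ) (u₀ : T3 → V3), Continuous a → Continuous θ₀ → Continuous u₀ → (∀ x, 0 < a x) →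
      (∀ x, 0 < θ₀ x) → ∀ σ : ℝ, 0 < σ → σ ^ 3 * (⨆ x, a x) ≤ η₀ * ∫ x, a x →
      ∃ ρ₀ : T3 → ℝ, Continuous ρ₀ ∧ (∀ x, 0 < ρ₀ x) ∧
        (∀ (N : ℕ) (Φ : HardSphereFlow (Torus.geometry (Fin 3)) (hsDiameter σ N) (N + 1)),
          IsProbabilityMeasure (localGibbsLaw σ a u₀ θ₀ N Φ)) ∧
        ∀ χ : T3 → ℝ, Continuous χ → ∀ δ : ℝ, 0 < δ → ∃ C : ℝ, 0 < C ∧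
          ∀ (N : ℕ) (Φ : HardSphereFlow (Torus.geometry (Fin 3)) (hsDiameter σ N) (N + 1)),
            localGibbsLaw σ a u₀ θ₀ N Φ {z | δ < |empiricalDensityField z χ - ∫ x, χ x * ρ₀ x|} ≤
                ENNReal.ofReal (C * Real.exp (-(C⁻¹ * ((N : ℝ) + 1)))) ∧
              localGibbsLaw σ a u₀ θ₀ N Φ
                  {z | δ < ‖empiricalMomentumField z χ - ∫ x, (χ x * ρ₀ x) • u₀ x‖} ≤
                ENNReal.ofReal (C * Real.exp (-(C⁻¹ * ((N : ℝ) + 1)))) ∧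
              localGibbsLaw σ a u₀ θ₀ N Φ {z | δ < |empiricalEnergyField z χ -
                  ∫ x, χ x * totalEnergyDensity (ρ₀ x) (u₀ x) (θ₀ x)|} ≤
                ENNReal.ofReal (C * Real.exp (-(C⁻¹ * ((N : ℝ) + 1))))) →
    HsEosLowDensity → DiluteSelfConsistency →
    ∀ (a₀ θ₀ : T3 → ℝ) (u₀ : T3 → V3), Continuous a₀ → Continuous θ₀ → Continuous u₀ →
      (∀ x, 0 < a₀ x) → (∀ x, 0 < θ₀ x) →
      ∃ σ₀ : ℝ, 0 < σ₀ ∧ ∀ σ : ℝ, 0 < σ → σ < σ₀ →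
        ∀ (T : ℝ) (ρ θ : ℝ → T3 → ℝ) (u : ℝ → T3 → V3), IsHardSphereEulerSolution σ T ρ u θ →
          ∀ Φ : (N : ℕ) → HardSphereFlow (Torus.geometry (Fin 3)) (hsDiameter σ N) (N + 1),
            TendstoHydroFieldsAt (fun N => localGibbsLaw σ a₀ u₀ θ₀ N (Φ N)) Φ ρ u θ 0 →
            ∀ t ∈ Set.Ioo 0 T, ∀ (hac : Continuous fun x => ρ t x * Rf (σ ^ 3 * ρ t x))
              (hap : ∀ x, 0 < ρ t x * Rf (σ ^ 3 * ρ t x)),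
              (∀ x, ρ t x ≤ ρ t x * Rf (σ ^ 3 * ρ t x) ∧ ρ t x * Rf (σ ^ 3 * ρ t x) ≤ 2 * ρ t x) →
              SmallDensity (profileOf (fun x => ρ t x * Rf (σ ^ 3 * ρ t x)) hac hap) σ →
              rhoLim (profileOf (fun x => ρ t x * Rf (σ ^ 3 * ρ t x)) hac hap) σ = ρ t →
              Tendsto (fun N : ℕ => klDiv ((Φ N).lawAt (localGibbsLaw σ a₀ u₀ θ₀ N (Φ N)) t)
                (localGibbsLaw σ (fun x => ρ t x * Rf (σ ^ 3 * ρ t x)) (u t) (θ t) N (Φ N)) /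
                  ((N : ℝ≥0∞) + 1)) atTop (𝓝 0)

/-- **S1 — reduction of the crux to its Gronwall core** (all statics discharged): the core and
`DiluteSelfConsistency` give the sub-problem Statement. Proof plan: `uniformLocalGibbsConcentration_proof`
(14445) supplies `η₀` and the matrix, `HsEosLowDensity_holds` the EOS, `stub_eosRatioAnalytic` the insertion
factor; then the bookkeeping of `EntropyClockDock.clampedWindowDock_of_core` / `_of_gronwallRf` (time-zero
slice, packing of `ρ_t` from DSC, `activity_of_density`, `tie_rhoLim_of_smallDensity`, `data_eq_of_ties`)
produces the consequent of `TwoClocks.RelEntropyVanishing`, and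
`hydrodynamicLimit_of_relEntropyVanishing` concludes. Verbatim the line skeleton's `CoherenceNotTails.CoreToHydro`
(the registered signature of `stub_reduction`); proved below. -/
def CoreToHydro : Prop :=
  RelEntropyCoreRf → DiluteSelfConsistency → _root_.HydrodynamicLimit

/-! ### §2 Mass conservation and unit admissible mass (PRIVATE re-proofs) -/

-- adapted from `EntropyClockDock.integral_density_eq` (Theorems/TwoClocksClampedWindowDockGronwall.lean, private
-- there), itself from `DenseExcursionEverywhere.integral_density_eq`
/-- **Mass is conserved** along every classical hard-sphere-Euler solution: `∫ ρ(t) = ∫ ρ(0)` on `[0, T)` (only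
the continuity equation is integrated, `∫ div = 0` on the torus). [folklore] -/
private theorem integral_density_eq {σ T : ℝ} {ρ θ : ℝ → T3 → ℝ} {u : ℝ → T3 → V3}
    (hE : IsHardSphereEulerSolution σ T ρ u θ) {t : ℝ} (ht : t ∈ Ico 0 T) :
    ∫ x, ρ t x = ∫ x, ρ 0 x := by
  have hderiv : ∀ s ∈ Ico 0 T, HasDerivWithinAt (fun s => ∫ x, ρ s x) 0 (Ico 0 T) s := by
    intro s hs
    have h1 := hE.smooth_density.hasDerivWithinAt_integral (convex_Ico 0 T) hs
    have h2 : ∫ x, Torus.timeDerivWithin (Ico 0 T) ρ s x = 0 := by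
      have hpt : (fun x => Torus.timeDerivWithin (Ico 0 T) ρ s x) =
          fun x => -Torus.divergence (fun y => ρ s y • u s y) x := by
        funext x; have := hE.mass s hs x; linarith
      rw [hpt, integral_neg, neg_eq_zero]
      exact Torus.integral_divergence_eq_zero_holds
        ((hE.smooth_density.smul hE.smooth_velocity).isSmooth_slice hs)
    rwa [h2] at h1
  have hcont : ContinuousOn (fun s => ∫ x, ρ s x) (Icc 0 t) := fun s hs =>
    ((hderiv s ⟨hs.1, hs.2.trans_lt ht.2⟩).continuousWithinAt).mono (Icc_subset_Ico_right ht.2)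
  have hright : ∀ s ∈ Ico 0 t, HasDerivWithinAt (fun s => ∫ x, ρ s x) 0 (Ici s) s := by
    intro s hs
    have hsT : s ∈ Ico 0 T := ⟨hs.1, hs.2.trans ht.2⟩
    refine (hderiv s hsT).mono_of_mem_nhdsWithin ?_
    exact Filter.mem_of_superset (Ico_mem_nhdsGE hsT.2) (Ico_subset_Ico_left hsT.1)
  exact constant_of_has_deriv_right_zero hcont hright t (right_mem_Icc.2 ht.1)

-- adapted from `EntropyClockDock.integral_density_zero_eq_one` (ibid.), itself from
-- `DenseExcursionEverywhere.integral_density_zero_eq_one`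
/-- **Admissible mass is one**: the `t = 0` tie tested with `χ ≡ 1` (empirical density identically `1`, laws of
total mass `1` for `σ ≤ 1/2`) forces `∫ ρ(0) = 1`. [folklore] -/
private theorem integral_density_zero_eq_one {σ : ℝ} (hσ2 : σ ≤ 1 / 2) {a₀ θ₀ : T3 → ℝ} {u₀ : T3 → V3}
    (ha : Continuous a₀) (hθ : Continuous θ₀) (hu : Continuous u₀) (ha0 : ∀ x, 0 < a₀ x)
    (hθ0 : ∀ x, 0 < θ₀ x) {ρ θ : ℝ → T3 → ℝ} {u : ℝ → T3 → V3}
    (Φ : (N : ℕ) → HardSphereFlow (Torus.geometry (Fin 3)) (hsDiameter σ N) (N + 1))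
    (hA : TendstoHydroFieldsAt (fun N => localGibbsLaw σ a₀ u₀ θ₀ N (Φ N)) Φ ρ u θ 0) :
    ∫ x, ρ 0 x = 1 := by
  by_contra hne
  have hd : 0 < |1 - ∫ x, ρ 0 x| := abs_pos.2 (sub_ne_zero.2 (Ne.symm hne))
  have h := (hA (fun _ => 1) continuous_const (|1 - ∫ x, ρ 0 x| / 2) (by positivity)).1
  have hev : ∀ N : ℕ, {z : Config (N + 1) (Fin 3) T3 | |1 - ∫ x, ρ 0 x| / 2 <
      |empiricalDensityField ((Φ N).flow 0 z) (fun _ => 1) - ∫ x, (fun _ => (1 : ℝ)) x * ρ 0 x|} = univ := by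
    intro N
    ext z
    simp only [mem_setOf_eq, mem_univ, iff_true, empiricalDensityField_one (Nat.succ_ne_zero N), one_mul]
    linarith
  have hP : ∀ N, IsProbabilityMeasure (localGibbsLaw σ a₀ u₀ θ₀ N (Φ N)) :=
    fun N => isProbabilityMeasure_localGibbsLaw ha hθ hu ha0 hθ0 hσ2 N (Φ N)
  simp only [hev, measure_univ] at h
  exact one_ne_zero (tendsto_nhds_unique (tendsto_const_nhds (x := (1 : ℝ≥0∞)) (f := atTop)) h)

/-! ### §3 The stub -/

/-- **STUB S1 `stub_reduction : CoreToHydro`** of line `IdeatorTwoSketch` (crux `ClampedCurrentsDock`,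
stmt-AtomisticToContinuum-14680): the Gronwall core `RelEntropyCoreRf` and `DiluteSelfConsistency` imply the
sub-problem Statement `HydrodynamicLimit`. By `hydrodynamicLimit_of_relEntropyVanishing` (which concludes the
unguarded Literature conjecture; bridged to the packing-guarded conjunct of the statement re-type D-0032 by
`HydrodynamicLimit.of_unguarded`), it suffices to produce, profile by profile, the consequent of `RelEntropyVanishing`; `σ₀ := min σc (min σd (min (1/2) (η₀∫a₀/sup a₀)))`
with `σc` from the core (fed `stub_eosRatioAnalytic`'s insertion factor, the matrix of
`uniformLocalGibbsConcentration_proof` at its `η₀`, `HsEosLowDensity_holds` and `DiluteSelfConsistency`) and `σd`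
from `DiluteSelfConsistency` at `η := min η₁ (η₀/2)`; the probability clause is `isProbabilityMeasure_localGibbsLaw`;
`t = 0` is `EntropyClockDock.timeZero_slice`; for `t ∈ (0, T)` the reference activity is `a_t = ρ_t Rf(σ³ρ_t)`
(`activity_of_density` at packing `σ³ sup ρ_t ≤ η₁`, unit mass by `integral_density_eq` /
`integral_density_zero_eq_one`), `η₀`-dilute since `a_t ≤ 2ρ_t`, `σ³ sup ρ_t ≤ η₀/2`, `∫a_t ≥ ∫ρ_t = 1`; its laws
are probability measures and concentrate exponentially around an anonymous `(ρ₁, ρ₁u_t, E(ρ₁,u_t,θ_t))` (matrix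
of 14445), `ρ₁ = ρ_t` by `data_eq_of_ties` against the tie `tie_rhoLim_of_smallDensity` (`rhoLim = ρ_t`), and
`KL/(N+1) → 0` is the core. [cite: Yau1991, §2] -/
theorem stub_reduction : CoreToHydro := by
  intro hcore hS
  -- the insertion factor of the activity inversion (a proved theorem despite its name)
  obtain ⟨r, hr, Rf, -, -, -, hsol, hbd, hLip, huniq⟩ := stub_eosRatioAnalytic
  have hcont : ContinuousOn Rf (Icc 0 r) := by
    obtain ⟨L, hL⟩ := hLip
    exact hL.continuousOn
  -- the `η₀`-uniform exponential LLN (stmt-14445, proved)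
  obtain ⟨η₀, hη₀, HU⟩ := uniformLocalGibbsConcentration_proof
  -- statement re-type D-0032 (2026-08-16): `_root_.HydrodynamicLimit` is the packing-guarded conjunct; the
  -- Literature-valued entropy inequality is bridged by `HydrodynamicLimit.of_unguarded`
  refine _root_.HydrodynamicLimit.of_unguarded
    (hydrodynamicLimit_of_relEntropyVanishing fun a₀ θ₀ u₀ ha hθ hu ha0 hθ0 => ?_)
  -- the core at these data
  obtain ⟨σc, hσc, Hc⟩ :=
    hcore r Rf hr hsol hbd hcont huniq η₀ hη₀ HU HsEosLowDensity_holds hS a₀ θ₀ u₀ ha hθ hu ha0 hθ0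
  -- the packing threshold of `activity_of_density`
  set η₁ : ℝ := min (r / (2 * (2 * (2 * Real.exp 1 + 1)))) (1 / (64 * Real.exp 1 * v₁))
  have hη₁ : 0 < η₁ := lt_min (by positivity) (by have := v₁_pos; positivity)
  -- dilute self-consistency at `η = min η₁ (η₀/2)`
  obtain ⟨σd, hσd, Hd⟩ := hS (min η₁ (η₀ / 2)) (lt_min hη₁ (by positivity)) a₀ θ₀ u₀ ha hθ hu ha0 hθ0
  -- the initial activity is `η₀`-dilute for `σ ≤ min (1/2) (η₀ ∫a₀ / sup a₀)`
  have hI : 0 < ∫ x, a₀ x := integral_pos_of_continuous_pos ha ha0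
  have hbdd : BddAbove (Set.range a₀) := (isCompact_range ha).bddAbove
  have hSpos : 0 < ⨆ x, a₀ x := (ha0 0).trans_le (le_ciSup hbdd 0)
  have hg : 0 < η₀ * (∫ x, a₀ x) / ⨆ x, a₀ x := div_pos (mul_pos hη₀ hI) hSpos
  refine ⟨min σc (min σd (min (1 / 2) (η₀ * (∫ x, a₀ x) / ⨆ x, a₀ x))),
    lt_min hσc (lt_min hσd (lt_min (by norm_num) hg)), fun σ hσ hσlt T ρ θ u hE Φ => ?_⟩
  have hσc' : σ < σc := hσlt.trans_le (min_le_left _ _)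
  have hσd' : σ < σd := hσlt.trans_le ((min_le_right _ _).trans (min_le_left _ _))
  have hσ2' : σ < 1 / 2 :=
    hσlt.trans_le ((min_le_right _ _).trans ((min_le_right _ _).trans (min_le_left _ _)))
  have hσ2 : σ ≤ 1 / 2 := hσ2'.le
  have hσg : σ ≤ η₀ * (∫ x, a₀ x) / ⨆ x, a₀ x :=
    (hσlt.trans_le ((min_le_right _ _).trans ((min_le_right _ _).trans (min_le_right _ _)))).le
  have hguard : σ ^ 3 * (⨆ x, a₀ x) ≤ η₀ * ∫ x, a₀ x := by
    have h31 : σ ^ 3 ≤ σ := pow_le_of_le_one hσ.le (hσ2.trans (by norm_num)) three_ne_zero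
    calc σ ^ 3 * (⨆ x, a₀ x) ≤ σ * ⨆ x, a₀ x := mul_le_mul_of_nonneg_right h31 hSpos.le
      _ ≤ η₀ * (∫ x, a₀ x) / (⨆ x, a₀ x) * ⨆ x, a₀ x := mul_le_mul_of_nonneg_right hσg hSpos.le
      _ = η₀ * ∫ x, a₀ x := div_mul_cancel₀ _ hSpos.ne'
  refine ⟨fun N => isProbabilityMeasure_localGibbsLaw ha hθ hu ha0 hθ0 hσ2 N (Φ N), fun htie t ht => ?_⟩
  obtain ⟨ρ₀, hρ₀c, hρ₀pos, -, hconc⟩ := HU a₀ θ₀ u₀ ha hθ hu ha0 hθ0 σ hσ hguard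
  rcases ht.1.eq_or_lt with h0 | htpos
  · -- `t = 0`: the data are pinned, the reference IS the initial law, `KL = 0`
    subst h0
    exact timeZero_slice hσ2 ha hθ hu ha0 hθ0 hρ₀c hρ₀pos hconc hE ht.2 Φ htie
  · -- `0 < t < T`: the Euler slice at time `t`
    have hρtc : Continuous (ρ t) := (hE.smooth_density.isSmooth_slice ht).continuous
    have hutc : Continuous (u t) := (hE.smooth_velocity.isSmooth_slice ht).continuous
    have hθtc : Continuous (θ t) := (hE.smooth_temperature.isSmooth_slice ht).continuous
    have hρtpos : ∀ x, 0 < ρ t x := hE.density_pos t ht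
    have hθtpos : ∀ x, 0 < θ t x := hE.temperature_pos t ht
    have hmass : ∫ x, ρ t x = 1 :=
      (integral_density_eq hE ht).trans (integral_density_zero_eq_one hσ2 ha hθ hu ha0 hθ0 Φ htie)
    -- packing of `ρ_t` from dilute self-consistency
    have hpack : ∀ x, ρ t x * σ ^ 3 < min η₁ (η₀ / 2) := fun x => Hd σ hσ hσd' T ρ θ u hE Φ htie t ht x
    have hbddρ : BddAbove (Set.range (ρ t)) := (isCompact_range hρtc).bddAbove
    obtain ⟨xM, -, hxM⟩ := isCompact_univ.exists_isMaxOn univ_nonempty hρtc.continuousOn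
    have hsup : (⨆ x, ρ t x) = ρ t xM :=
      le_antisymm (ciSup_le fun x => (isMaxOn_iff.mp hxM) x (mem_univ x)) (le_ciSup hbddρ xM)
    have hpack₁ : σ ^ 3 * (⨆ x, ρ t x) ≤ η₁ := by
      rw [hsup, mul_comm]; exact ((hpack xM).trans_le (min_le_left _ _)).le
    have hpack₀ : σ ^ 3 * (⨆ x, ρ t x) ≤ η₀ / 2 := by
      rw [hsup, mul_comm]; exact ((hpack xM).trans_le (min_le_right _ _)).le
    -- the inverted activity `a_t = ρ_t · Rf(σ³ ρ_t)`: `ρ_t ≤ a_t ≤ 2ρ_t`, statics regime, `rhoLim = ρ_t`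
    obtain ⟨hac, hap, hale, hQs, hlim⟩ :=
      activity_of_density hr hsol hbd hcont huniq hσ hσ2' hρtc hρtpos hmass hpack₁
    -- `η₀`-diluteness of `a_t`: `σ³ sup a_t ≤ 2 σ³ sup ρ_t ≤ η₀ ≤ η₀ ∫a_t`
    have haguard : σ ^ 3 * (⨆ x, ρ t x * Rf (σ ^ 3 * ρ t x)) ≤ η₀ * ∫ x, ρ t x * Rf (σ ^ 3 * ρ t x) := by
      have hsupa : (⨆ x, ρ t x * Rf (σ ^ 3 * ρ t x)) ≤ 2 * ⨆ x, ρ t x :=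
        ciSup_le fun x => (hale x).2.trans (mul_le_mul_of_nonneg_left (le_ciSup hbddρ x) zero_le_two)
      have hinta : 1 ≤ ∫ x, ρ t x * Rf (σ ^ 3 * ρ t x) := by
        have h := integral_mono (integrable_of_continuous_T3 hρtc) (integrable_of_continuous_T3 hac)
          fun x => (hale x).1
        linarith [hmass]
      have hσ3 : 0 ≤ σ ^ 3 := by positivity
      calc σ ^ 3 * (⨆ x, ρ t x * Rf (σ ^ 3 * ρ t x)) ≤ σ ^ 3 * (2 * ⨆ x, ρ t x) :=
            mul_le_mul_of_nonneg_left hsupa hσ3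
        _ = 2 * (σ ^ 3 * ⨆ x, ρ t x) := by ring
        _ ≤ 2 * (η₀ / 2) := by gcongr
        _ = η₀ * 1 := by ring
        _ ≤ η₀ * ∫ x, ρ t x * Rf (σ ^ 3 * ρ t x) := mul_le_mul_of_nonneg_left hinta hη₀.le
    -- the reference tie: the laws of `(a_t, u_t, θ_t)` are tied to `(ρ_t, u_t, θ_t)`
    have hatie : TendstoHydroFieldsAt
        (fun N => localGibbsLaw σ (fun x => ρ t x * Rf (σ ^ 3 * ρ t x)) (u t) (θ t) N (Φ N)) Φ
        (fun _ => ρ t) (fun _ => u t) (fun _ => θ t) 0 := by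
      have h := tie_rhoLim_of_smallDensity (u₀ := u t) hac hθtc hutc hap hθtpos hσ2 hQs Φ
      simp only [hlim] at h
      exact h
    -- Yau's estimate, from the core
    have hkl := Hc σ hσ hσc' T ρ θ u hE Φ htie t ⟨htpos, ht.2⟩ hac hap hale hQs hlim
    -- exponential concentration of the reference (matrix of 14445 at `a_t`), its LLN density pinned to `ρ_t`
    obtain ⟨ρ₁, hρ₁c, hρ₁pos, hprob, hconc₁⟩ :=
      HU (fun x => ρ t x * Rf (σ ^ 3 * ρ t x)) (θ t) (u t) hac hθtc hutc hap hθtpos σ hσ haguard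
    obtain ⟨hρt, -, -⟩ := data_eq_of_ties hσ2 Φ hac hθtc hutc hap hθtpos hρ₁c hρ₁pos
      (tie_of_expConc Φ hconc₁) (ρ := fun _ => ρ t) (u := fun _ => u t) (θ := fun _ => θ t)
      hρtc hutc hθtc hatie
    subst hρt
    refine ⟨_, fun N => hprob N (Φ N), fun χ hχ δ hδ => ?_, hkl⟩
    obtain ⟨C, hC, hN⟩ := hconc₁ χ hχ δ hδ
    exact ⟨C, hC, fun N => hN N (Φ N)⟩

end Summit.AtomisticToContinuum.HydrodynamicLimit.Theorems.ClampedCurrentsDockReduction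

end
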